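import Summits.FinalStateConjecture.FinalStateConjecture.Theorems.EIHFluxBalanceInertialRecessionVirialNoReturn

/-!
# Route EIHFluxBalance — crux `InertialRecession`, abstract endgame for general `N`:
# the kinematic no-return lemma, integrated form (toward LEMMA SPLIT, visits)

Helper file for the crux `stmt-FinalStateConjecture-10166` (virial route, `work/split/PLAN.md`, N = 3 doubly-bad case, block L1).
Mathlib-only, pure real analysis: `no_return_integrated`, the variant of `no_return_long` whose far-interval hypothesis is the
integrated straightness `‖D s − D a − (s − a)•W‖ ≤ e(s − a)` rather than a frozen derivative.
-/

noncomputable section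

open Set Filter Topology

namespace Summit.FinalStateConjecture.FinalStateConjecture.Theorems.SublinearIsFree.Virial

open Literature.Geometry.Lorentzian

set_option maxHeartbeats 400000 in
/-- **The kinematic no-return lemma, integrated form**: as `no_return_long`, but the hypothesis on a long far interval
`[a, b]` is directly the INTEGRATED straightness `‖D s − D a − (s − a)•W‖ ≤ e(s − a)` for one vector `W` (what the
mean value inequality gave from a frozen derivative); this is the form available when the derivative deviates briefly during
fast visits. [folklore] -/
theorem no_return_integrated {D : ℝ → E3} (hD : Differentiable ℝ D) {η e B s₀ K T₀ : ℝ} (hT₀ : 0 < T₀) (hK : 2 ≤ K)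
    (hη : 0 < η) (he : 0 ≤ e) (hB : 0 ≤ B)
    (hspeed : ∀ s, T₀ ≤ s → ‖deriv D s‖ ≤ 2) (hbound : ∀ s, T₀ ≤ s → ‖D s‖ ≤ B * s)
    (hstraight : ∀ a b : ℝ, T₀ ≤ a → a ≤ b → (s₀ / 2 - (η + B / K)) / 2 * a ≤ b - a →
      (∀ s ∈ Icc a b, η * s ≤ ‖D s‖) → ∃ W : E3, ∀ s ∈ Icc a b, ‖D s - D a - (s - a) • W‖ ≤ e * (s - a))
    (h1 : 2 * η ≤ s₀ / 2 - (η + B / K) - 2 * e)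
    (h2 : 2 * η + (η + B / K) ≤ (s₀ / 2 - (η + B / K) - 2 * e) * ((s₀ / 2 - (η + B / K)) / 2))
    {t₀ : ℝ} (ht₀ : K * T₀ ≤ t₀) (hbig : s₀ * t₀ / 2 ≤ ‖D t₀‖) :
    ∀ t, t₀ ≤ t → η * t ≤ ‖D t‖ := by
  have hDc : Continuous D := hD.continuous
  have hK0 : 0 < K := by linarith
  have ht₀0 : 0 < t₀ := lt_of_lt_of_le (by positivity) ht₀
  have hTt : T₀ ≤ t₀ / K := by rw [le_div_iff₀ hK0]; linarith [mul_comm K T₀]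
  have htK : t₀ / K < t₀ := by rw [div_lt_iff₀ hK0]; nlinarith
  have hBK : 0 ≤ B / K := by positivity
  -- abbreviations for the constants
  obtain ⟨ε₁, hε₁⟩ : ∃ ε₁ : ℝ, ε₁ = η + B / K := ⟨_, rfl⟩
  have hε₁0 : 0 ≤ ε₁ := by rw [hε₁]; positivity
  have hw0 : 2 * η ≤ s₀ / 2 - ε₁ - 2 * e := by rw [hε₁]; exact h1
  have hw2 : 2 * η + ε₁ ≤ (s₀ / 2 - ε₁ - 2 * e) * ((s₀ / 2 - ε₁) / 2) := by rw [hε₁]; exact h2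
  have hc0 : 0 ≤ s₀ / 2 - ε₁ := by nlinarith
  -- the closed set `S = {η s ≤ ‖D s‖}`
  obtain ⟨S, hSdef⟩ : ∃ S : Set ℝ, S = {s | η * s ≤ ‖D s‖} := ⟨_, rfl⟩
  have hSc : IsClosed S := by rw [hSdef]; exact isClosed_le (by fun_prop) (by fun_prop)
  have hmemS : ∀ s, s ∈ S ↔ η * s ≤ ‖D s‖ := fun s ↦ by rw [hSdef]; rfl
  -- Step 1: the entry time `a`
  obtain ⟨A, hAdef⟩ : ∃ A : Set ℝ, A = ({s | ‖D s‖ ≤ η * s} ∩ Icc (t₀ / K) t₀) ∪ {t₀ / K} := ⟨_, rfl⟩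
  have hAc : IsClosed A := by
    rw [hAdef]
    exact ((isClosed_le (by fun_prop) (by fun_prop)).inter isClosed_Icc).union isClosed_singleton
  have hKA : t₀ / K ∈ A := by rw [hAdef]; exact Or.inr rfl
  have hAne : A.Nonempty := ⟨t₀ / K, hKA⟩
  have hAle : ∀ s ∈ A, s ≤ t₀ := by
    intro s hs
    rw [hAdef] at hs
    rcases hs with hs | hs
    · exact hs.2.2
    · rw [mem_singleton_iff.mp hs]; exact htK.le
  have hAbdd : BddAbove A := ⟨t₀, hAle⟩
  obtain ⟨a, hadef⟩ : ∃ a : ℝ, a = sSup A := ⟨_, rfl⟩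
  have ha : a ∈ A := by rw [hadef]; exact hAc.csSup_mem hAne hAbdd
  have haK : t₀ / K ≤ a := by rw [hadef]; exact le_csSup hAbdd hKA
  have hat₀ : a ≤ t₀ := by rw [hadef]; exact csSup_le hAne hAle
  have hTa : T₀ ≤ a := hTt.trans haK
  have hDa : ‖D a‖ ≤ ε₁ * t₀ := by
    have ha' := ha
    rw [hAdef] at ha'
    rcases ha' with ⟨hle, -⟩ | hs
    · calc ‖D a‖ ≤ η * a := hle
        _ ≤ η * t₀ := mul_le_mul_of_nonneg_left hat₀ hη.le
        _ ≤ ε₁ * t₀ := by rw [hε₁]; nlinarith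
    · have hs' : a = t₀ / K := mem_singleton_iff.mp hs
      calc ‖D a‖ ≤ B * a := hbound a hTa
        _ = B / K * t₀ := by rw [hs']; field_simp
        _ ≤ ε₁ * t₀ := by rw [hε₁]; nlinarith
  have ha_lt : a < t₀ := by
    rcases lt_or_eq_of_le hat₀ with h | h
    · exact h
    · exfalso
      have ha' := ha
      rw [hAdef] at ha'
      rcases ha' with ⟨hle, -⟩ | hs
      · rw [h] at hle
        have hle' : ‖D t₀‖ ≤ η * t₀ := hle
        have : η < s₀ / 2 := by nlinarith
        nlinarith
      · have : a = t₀ / K := mem_singleton_iff.mp hs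
        linarith
  -- `(a, t₀] ⊆ S`, hence `[a, t₀] ⊆ S`
  have hIoc : Ioc a t₀ ⊆ S := by
    intro s hs
    rw [hmemS]
    by_contra hns
    have hsA : s ∈ A := by
      rw [hAdef]
      exact Or.inl ⟨(not_le.mp hns).le, haK.trans hs.1.le, hs.2⟩
    have : s ≤ a := by rw [hadef]; exact le_csSup hAbdd hsA
    linarith [hs.1]
  have hIcc0 : Icc a t₀ ⊆ S := by
    rw [← closure_Ioc ha_lt.ne]
    exact hSc.closure_subset_iff.mpr hIoc
  -- Step 2: the estimate on a bootstrap interval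
  have hest : ∀ t, t₀ ≤ t → Icc t₀ t ⊆ S → 2 * η * t ≤ ‖D t‖ := by
    intro t ht hsub
    have hall : ∀ s ∈ Icc a t, η * s ≤ ‖D s‖ := fun s hs ↦ by
      rcases le_total s t₀ with h | h
      · exact (hmemS s).mp (hIcc0 ⟨hs.1, h⟩)
      · exact (hmemS s).mp (hsub ⟨h, hs.2⟩)
    have hsp := norm_sub_le_two_mul_of_speed hD hat₀ fun s hs ↦ hspeed s (hTa.trans hs.1)
    have hta0 : 0 < t₀ - a := by linarith
    -- the far interval `[a, t]` is long: `t₀ - a ≥ (s₀/2 - ε₁) t₀ / 2`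
    have hta1 : (s₀ / 2 - ε₁) * t₀ ≤ 2 * (t₀ - a) := by
      have := norm_sub_norm_le (D t₀) (D a)
      linarith
    have hlen : (s₀ / 2 - (η + B / K)) / 2 * a ≤ t - a := by
      rw [← hε₁]
      have : (s₀ / 2 - ε₁) * a ≤ (s₀ / 2 - ε₁) * t₀ := mul_le_mul_of_nonneg_left hat₀ hc0
      linarith
    obtain ⟨W, hW⟩ := hstraight a t hTa (hat₀.trans ht) hlen hall
    have e0 := hW t₀ ⟨hat₀, ht⟩
    have e1 := hW t ⟨hat₀.trans ht, le_rfl⟩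
    -- `X (t₀ - a) ≥ s₀ t₀ / 2 - ε₁ t₀ - e (t₀ - a)`
    have hX1 : s₀ * t₀ / 2 - ε₁ * t₀ - e * (t₀ - a) ≤ ‖W‖ * (t₀ - a) := by
      have h3 : ‖D t₀‖ ≤ ‖D t₀ - D a - (t₀ - a) • W‖ + ‖D a‖ + ‖(t₀ - a) • W‖ := by
        calc ‖D t₀‖ = ‖(D t₀ - D a - (t₀ - a) • W) + D a + (t₀ - a) • W‖ := by congr 1; abel
          _ ≤ ‖D t₀ - D a - (t₀ - a) • W‖ + ‖D a‖ + ‖(t₀ - a) • W‖ := norm_add₃_le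
      have h4 : ‖(t₀ - a) • W‖ = ‖W‖ * (t₀ - a) := by
        rw [norm_smul, Real.norm_eq_abs, abs_of_pos hta0, mul_comm]
      linarith
    -- `t₀ - a ≥ (s₀/2 - ε₁) t₀ / 2`
    have hta : (s₀ / 2 - ε₁) * t₀ ≤ 2 * (t₀ - a) := by
      have := norm_sub_norm_le (D t₀) (D a)
      linarith
    -- `‖W‖ ≥ s₀/2 - ε₁ - e`
    have hw : s₀ / 2 - ε₁ - e ≤ ‖W‖ := by
      have h5 : (s₀ / 2 - ε₁) * (t₀ - a) ≤ (s₀ / 2 - ε₁) * t₀ := mul_le_mul_of_nonneg_left (by linarith) hc0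
      have h6 : (s₀ / 2 - ε₁ - e) * (t₀ - a) ≤ ‖W‖ * (t₀ - a) := by nlinarith
      exact le_of_mul_le_mul_right h6 hta0
    -- `‖D t‖ ≥ (t - a) ‖W‖ - ε₁ t₀ - e (t - a)`
    have hfin : (t - a) * ‖W‖ - ε₁ * t₀ - e * (t - a) ≤ ‖D t‖ := by
      have h3 : ‖(t - a) • W‖ ≤ ‖D t‖ + ‖D t - D a - (t - a) • W‖ + ‖D a‖ := by
        calc ‖(t - a) • W‖ = ‖D t - (D t - D a - (t - a) • W) - D a‖ := by congr 1; abel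
          _ ≤ ‖D t - (D t - D a - (t - a) • W)‖ + ‖D a‖ := norm_sub_le _ _
          _ ≤ ‖D t‖ + ‖D t - D a - (t - a) • W‖ + ‖D a‖ := by
              linarith [norm_sub_le (D t) (D t - D a - (t - a) • W)]
      have h4 : ‖(t - a) • W‖ = (t - a) * ‖W‖ := by
        rw [norm_smul, Real.norm_eq_abs, abs_of_nonneg (by linarith)]
      linarith
    -- combine
    have h7 : 2 * η ≤ ‖W‖ - e := by linarith
    have h8a : (t - t₀) * (2 * η) ≤ (t - t₀) * (‖W‖ - e) := mul_le_mul_of_nonneg_left h7 (by linarith)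
    have h8r : (t - a) * (‖W‖ - e) = (t - t₀) * (‖W‖ - e) + (t₀ - a) * (‖W‖ - e) := by ring
    have hta' : (s₀ / 2 - ε₁) * t₀ / 2 ≤ t₀ - a := by linarith
    have hwe : s₀ / 2 - ε₁ - 2 * e ≤ ‖W‖ - e := by linarith
    have h10 : 0 ≤ s₀ / 2 - ε₁ - 2 * e := by linarith
    have h9 : (s₀ / 2 - ε₁) * t₀ / 2 * (s₀ / 2 - ε₁ - 2 * e) ≤ (t₀ - a) * (‖W‖ - e) :=
      mul_le_mul hta' hwe h10 (by linarith)
    have h11 : (2 * η + ε₁) * t₀ ≤ (s₀ / 2 - ε₁ - 2 * e) * ((s₀ / 2 - ε₁) / 2) * t₀ :=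
      mul_le_mul_of_nonneg_right hw2 ht₀0.le
    have h12 : (s₀ / 2 - ε₁ - 2 * e) * ((s₀ / 2 - ε₁) / 2) * t₀ = (s₀ / 2 - ε₁) * t₀ / 2 * (s₀ / 2 - ε₁ - 2 * e) := by
      ring
    have h13 : (t - a) * ‖W‖ - ε₁ * t₀ - e * (t - a) = (t - a) * (‖W‖ - e) - ε₁ * t₀ := by ring
    linarith
  -- Step 3: continuous induction
  have key : ∀ b, t₀ ≤ b → Icc t₀ b ⊆ S := by
    intro b _
    refine (hSc.inter isClosed_Icc).Icc_subset_of_forall_mem_nhdsGT_of_Icc_subset (hIcc0 ⟨hat₀, le_rfl⟩) ?_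
    intro u hu hsub
    have h2η := hest u hu.1 hsub
    have hu0 : 0 < u := by linarith only [hu.1, ht₀0]
    have hlt : η * u < ‖D u‖ := by nlinarith only [h2η, hη, hu0]
    have hopen : IsOpen {s : ℝ | η * s < ‖D s‖} := isOpen_lt (by fun_prop) (by fun_prop)
    refine mem_nhdsWithin_of_mem_nhds (Filter.mem_of_superset (hopen.mem_nhds hlt) fun s hs ↦ ?_)
    rw [hmemS]
    exact le_of_lt hs
  intro t ht
  exact (hmemS t).mp (key t ht ⟨ht, le_rfl⟩)

/-- Registered one-line helper of this file: integrated straightness from a frozen derivative (so that `no_return_integrated`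
implies `no_return_long`). [folklore] -/
theorem straight_of_deriv_frozen : open Literature.Geometry.Lorentzian Set in ∀ {D : ℝ → E3}, Differentiable ℝ D → ∀ {a b e : ℝ} {W : E3}, a ≤ b → (∀ s ∈ Icc a b, ‖deriv D s - W‖ ≤ e) → ∀ s ∈ Icc a b, ‖D s - D a - (s - a) • W‖ ≤ e * (s - a) :=
  fun hD _ _ _ _ _ hW _ hs ↦ norm_sub_sub_smul_le_of_deriv_frozen hD hs.1 fun u hu ↦ hW u ⟨hu.1, hu.2.trans hs.2⟩

end Summit.FinalStateConjecture.FinalStateConjecture.Theorems.SublinearIsFree.Virial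

end
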